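import Summits.QuantumFields.YangMills.Theorems.BalabanUVNodesN15PerCubeGreenCovariant
import Summits.QuantumFields.YangMills.Theorems.BalabanUVNodesN15PerCubeGreenJetCovD
import HarnessLib

/-!
# N15 = NE2, road (c) — PROGRAMME (PC), (PC-A′) «the COVARIANT GRADIENT entries of [B9] (3.42) in per-cube gauges», VII: ★★★★ THE COVARIANT DERIVATIVE THROUGH THE SCALAR COVARIANT
# GREEN's FUNCTION `(Δ_{R_U} + a·Q′*_UQ′_U)⁻¹` FOR EVERY `U(m)` BOND FIELD IN BAŁABAN's PRINTED CLASS (3.35) PER CUBE — n15-c∕265's discharges (summand `P := a·Q′_Tᵀ Q′_T` live, far row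
# zero, cut row box-local, per-cube gauges PRODUCED from ONE `Reg335Cube` datum per box) applied to n15-c∕274, the extra `a⁺`-letter one step before the cut box READ FROM THE SAME DATUM
# on the two-collar box (dag-n15-c g26, n15-c∕275)

Cell `pub-ymgap`, seat `pub-ymgap-dag-n15-c` (generation g26; R134 (a), s1; HUMAN RULING D-0062).  `bears_on: R4∕N15 · K3⁸ SpineGivenEndpointR13SepCoPHV (stmt-QuantumFields-27366)`;
filed `--kind proof --supports stmt-QuantumFields-27366 --as helper` — COUNT-NEUTRAL.  Two theorems, 0 `sorry`, no `def`.  Imports BY NAME n15-c∕265 `…PerCubeGreenCovariant` (through it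
262 `uN_scGlued_spec`, 264 `scP`, `scNV`, `scP_conj`, `hasMaj_scNV_cut_of_rows`, `one_sub_scPsi_comp_scNV_comp_scChi`, 263 `scChi_ne_zero_nbhd`) and n15-c∕274 `…PerCubeGreenJetCovD`
(`uN_scGluedCovD_spec`); dag-n15-w2 `uN_exists_gauge_localCoefLetters_of_reg335Cube` (r07∕g8), dag-n15-c `blockOf_shift_mem_cubeBlocks`, `mem_cubeBlocks_of_mem_inner` (n15-c∕127,
dag-n15-w3 cover rows).  Nothing in the tree is modified.

THE THEOREMS.  ★ `scShift_nbhd_mem_box2`: the site one step before the cut box and its `±e_ν` neighbours lie in the TWO-collar box `{x | B(x) ∈ c(2w+2,k) + [0,6w+5)}` (127's one-step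
enlargement twice).  ★★★★ `uN_scGreenCovD_of_reg335Box`: for odd `L ≥ 7`, `a₀ > 0`, colour index `ι` there are `δ, w₀, R₀, B, c_r` such that on every doubled torus of the cover
(`k ≥ 1`, `L^m ≥ w₀`), at King's mass, for trace-form `e`, every `U(m)`-valued site bond field `U` with `Reg335Cube scShift U L^{−k} Q²_k ξ C` on the two-collar box of every cut box, and
every `r_V` dominating the two explicit letter bounds with `r_V(1+|J⊕J|) + a₀|ι|(|ι|σ²+2σ) ≤ R₀`: THERE ARE per-cube unitary gauges `w_k` such that (i) for EVERY direction `μ`,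
`D_{U,μ}∘scGlued(w, U, scP, scNV) ≤ (1·(1 + r_Ve^{δ}c_r) + π)·B·e^{−(δ∕16)|y−y′|_T}`, `D_{U,μ} = covD L^{−k} (coordMat e Ad_{U_μ}) (· + e_μ)`, and (ii) `scGlued∘(Δ_{R_U} + scP) = 1 =
(Δ_{R_U} + scP)∘scGlued` (n15-c∕262 with the same gauges; the constants are the min ∕ max of 262's and 274's).

HONEST FRAMING ∕ LIMITS.  As n15-c∕265∕274: composition of LANDED theorems on MODEL carriers; the SHAPE of [B9] (3.42)'s gradient entry ∕ Cor. 3.6 ∕ Thm 3.7 with per-cube gauges at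
MODEL level, NOT the printed theorems; nothing of [B5]∕[B6]∕[B9] asserted.  NE2⁺ NOT PRINTED, NOT proved; N15 of record untouched (DISCHARGED AS CONSUMED, p687738); K3⁸ OPEN; counts of
record UNMOVED (typed 28∕28 · discharged 8∕27); one finite 𝕋⁴ at fixed ε per index — NOT infinite volume, NOT OS on ℝ⁴, NOT a mass gap, NOT Clay.  Restate-immune (no Theses import).
-/

noncomputable section

open scoped BigOperators Matrix Matrix.Norms.L2Operator

namespace Summit.QuantumFields.YangMills.BalabanUVNodes.N15.Gluing

open Real
open Literature.MathematicalPhysics.QuantumFieldTheory.Balaban1983to89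
open Literature.MathematicalPhysics.QuantumFieldTheory.Balaban1983to89.B5Prop11Plancherel (Tor fine unitVec)
open Literature.MathematicalPhysics.QuantumFieldTheory.Balaban1983to89.B11SectG (BlockNorm HasMaj hasMaj_zero)
open Literature.MathematicalPhysics.QuantumFieldTheory.Balaban1983to89.B6Prop26Gluing (mulOp)
open Literature.MathematicalPhysics.QuantumFieldTheory.Balaban1983to89.B6UnitTorusCarrier (unitTorusGeo)
open Literature.MathematicalPhysics.QuantumFieldTheory.Balaban1983to89.B9Eq335RegularityClasses (Reg335Cube)
open Literature.MathematicalPhysics.QuantumFieldTheory.King1986 (aK aK_pos aK_le)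
open Literature.MathematicalPhysics.QuantumFieldTheory.King1986.Torus (blockOf)
open Literature.Barriers.QuantumFields (traceForm)
open Summit.QuantumFields.YangMills.BalabanUVNodes.N15.BackgroundLayer (covLapM tCoefA tCoefC)
open Summit.QuantumFields.YangMills.BalabanUVNodes.N15.VectorPiece (bshiftEquiv bshiftEquiv_apply)
open Summit.QuantumFields.YangMills.BalabanUVNodes.N15.MatrixSpecies (mmulOp coordMat basisConst liftEquiv)
open Summit.QuantumFields.YangMills.BalabanUVNodes.N15.TwoGrid (chiCube cubeBlocks)
open Summit.QuantumFields.YangMills.BalabanUVNodes.N15.CurvedSpecies (gaugePair uN_exists_gauge_localCoefLetters_of_reg335Cube)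
open Summit.QuantumFields.YangMills.BalabanUVNodes.N15.MatrixSpecies (covD)

variable {d : ℕ}

section Green

variable {L : ℕ} [NeZero L]

/-- ★ **TWO STEPS FROM THE CUT BOX STAY IN THE TWO-COLLAR BOX**: if `χ_k(x + e_μ) ≠ 0` then `x`, every `x + e_ν` and every `x − e_ν` lie in `{x | B(x) ∈ c(2w+2,k) + [0,6w+5)}`
(n15-c∕127 `blockOf_shift_mem_cubeBlocks` twice: cut box → one-collar box → two-collar box). [cite: Balaban1985BackgroundPropagators, (3.35) p.396 («on □̃», shape)] -/
theorem scShift_nbhd_mem_box2 (hL : Odd L ∧ 1 < L) (hL7 : 7 ≤ L) (mv kk : ℕ) (hW2 : 2 ≤ L ^ mv) (k : Fin (d + 1) → ZMod (2 * L)) (μ : Fin (d + 1)) (x : ScX d L mv kk hL)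
    (hx : scChi d L mv kk hL k (scShift d L mv kk hL μ x) ≠ 0) :
    x ∈ {x : ScX d L mv kk hL | blockOf (L ^ kk) (cvM d L mv kk hL) x ∈ cubeBlocks (cvM d L mv kk hL) (coverCorner (cvM d L mv kk hL) (L ^ mv) L (2 * L ^ mv + 2) k) (6 * L ^ mv + 5)} ∧
      (∀ ν, scShift d L mv kk hL ν x ∈ {x : ScX d L mv kk hL | blockOf (L ^ kk) (cvM d L mv kk hL) x ∈ cubeBlocks (cvM d L mv kk hL) (coverCorner (cvM d L mv kk hL) (L ^ mv) L (2 * L ^ mv + 2) k) (6 * L ^ mv + 5)}) ∧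
      (∀ ν, (scShift d L mv kk hL ν).symm x ∈ {x : ScX d L mv kk hL | blockOf (L ^ kk) (cvM d L mv kk hL) x ∈ cubeBlocks (cvM d L mv kk hL) (coverCorner (cvM d L mv kk hL) (L ^ mv) L (2 * L ^ mv + 2) k) (6 * L ^ mv + 5)}) := by
  have hM : ∀ ν, cvM d L mv kk hL ν = 2 * L * L ^ mv := MP_succ_eq L mv kk hL
  have hS : 6 * L ^ mv + 5 ≤ 2 * L * L ^ mv := by
    have h7 : 7 * L ^ mv ≤ L * L ^ mv := Nat.mul_le_mul_right _ hL7
    have e : 2 * L * L ^ mv = 2 * (L * L ^ mv) := by ring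
    rw [e]; omega
  -- the point `x = (x + e_μ) − e_μ` lies in the one-collar box
  have h1 : blockOf (L ^ kk) (cvM d L mv kk hL) x ∈ cubeBlocks (cvM d L mv kk hL) (coverCorner (cvM d L mv kk hL) (L ^ mv) L (2 * L ^ mv + 1) k) (6 * L ^ mv + 3) := by
    have h := (scChi_ne_zero_nbhd hL hL7 mv kk k (scShift d L mv kk hL μ x) hx).2.2 μ
    rw [Equiv.symm_apply_apply] at h
    exact h
  have key := fun ν => blockOf_shift_mem_cubeBlocks (m₀ := 2 * L ^ mv + 2) (S₀ := 6 * L ^ mv + 5) hM (by omega) (by omega) hS h1 ν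
  refine ⟨(key 0).1, fun ν => (key ν).2.1, fun ν => ?_⟩
  simp only [Set.mem_setOf_eq, Equiv.addRight_symm, Equiv.coe_addRight, ← sub_eq_add_neg]
  exact (key ν).2.2

set_option maxHeartbeats 400000 in
/-- ★★★★ **THE COVARIANT DERIVATIVE THROUGH THE SCALAR COVARIANT GREEN's FUNCTION OF A `U(m)` FIELD IN BAŁABAN's PRINTED CLASS (3.35) PER CUBE**: for odd `L ≥ 7`, `a₀ > 0` and a
colour index `ι` there are `δ, w₀, R₀, B > 0`, `c_r ≥ 0` such that on every doubled torus of the cover (`k ≥ 1`, `L^m ≥ w₀`), at King's mass `a_K(a₀,L,k)·(L^k)^{d+1}`, for trace-form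
coordinates `e` of `𝔲(m)`, every `U(m)`-valued site bond field `U` with `Reg335Cube scShift U L^{−k} Q²_k ξ C` on the TWO-collar box `Q²_k` of each cut box, and every `r_V` dominating
the two displayed explicit bounds with `r_V(1+|J⊕J|) + a₀|ι|(|ι|σ² + 2σ) ≤ R₀` (`σ = (1 + r_VL^{−k})^{(d+1)L^k} − 1`): THERE ARE per-cube site gauges `w_k`, UNITARY EVERYWHERE, such that
(i) for EVERY direction `μ`, `covD L^{−k} (coordMat e Ad_{U_μ}) (· + e_μ)∘scGlued(w, U, scP, scNV) ≤ (1·(1 + r_Ve^{δ}c_r) + π)·B·e^{−(δ∕16)|y−y′|_T}` and (ii) `scGlued∘(Δ_{R_U} + scP) = 1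
= (Δ_{R_U} + scP)∘scGlued`.  MODEL carriers; the SHAPE of [B9] (3.42)'s gradient entry ∕ Cor. 3.6 ∕ Thm 3.7, not the printed theorems.
[cite: Balaban1985BackgroundPropagators, (3.42) p.397, (3.34)–(3.35) p.396, Cor. 3.6 p.408, Thm 3.7 (3.90) p.409, (3.50)–(3.52) p.400 (shape ∕ mechanism); Balaban1984PropagatorsII, (2.91)–(2.93) p.239] -/
theorem uN_scGreenCovD_of_reg335Box (hL : Odd L ∧ 1 < L) (hL7 : 7 ≤ L) {a₀ : ℝ} (ha₀ : 0 < a₀) (ι : Type) [Fintype ι] [DecidableEq ι] :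
    ∃ δ w₀ R₀ B cR : ℝ, 0 < δ ∧ 0 < R₀ ∧ 0 < B ∧ 0 ≤ cR ∧
      ∀ (mv kk : ℕ), 1 ≤ kk → w₀ ≤ ((L ^ mv : ℕ) : ℝ) →
      ∀ {mm : Type} [Fintype mm] [DecidableEq mm] [Nonempty mm] (e : Matrix mm mm ℂ ≃L[ℝ] (ι → ℝ)), (∀ A B : Matrix mm mm ℂ, traceForm A B = e A ⬝ᵥ e B) →
      ∀ (U : Fin (d + 1) → ScX d L mv kk hL → (Matrix mm mm ℂ)ˣ), (∀ μ x, (U μ x : Matrix mm mm ℂ) ∈ Matrix.unitaryGroup mm ℂ) →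
      ∀ (ξ C : ℝ), 0 < ξ → 0 ≤ C →
        (∀ k, Reg335Cube (scShift d L mv kk hL) U ((((L ^ kk : ℕ) : ℝ))⁻¹) {x : ScX d L mv kk hL | blockOf (L ^ kk) (cvM d L mv kk hL) x ∈ cubeBlocks (cvM d L mv kk hL) (coverCorner (cvM d L mv kk hL) (L ^ mv) L (2 * L ^ mv + 2) k) (6 * L ^ mv + 5)} ξ C) →
      ∀ (rV : ℝ), 0 ≤ rV →
        Fintype.card ι * (@basisConst ι _ (Matrix mm mm ℂ) Matrix.frobeniusNormedAddCommGroup Matrix.frobeniusNormedSpace e * (2 * Real.sqrt (Fintype.card mm)) * (Real.sqrt (Fintype.card mm) * ((C / ξ) * Real.exp (((((L ^ kk : ℕ) : ℝ))⁻¹) * (C / ξ))))) ≤ rV →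
        Fintype.card ι * (Fintype.card (Fin (d + 1)) * (Fintype.card ι * (@basisConst ι _ (Matrix mm mm ℂ) Matrix.frobeniusNormedAddCommGroup Matrix.frobeniusNormedSpace e * (2 * Real.sqrt (Fintype.card mm)) * (Real.sqrt (Fintype.card mm) * ((C / ξ) * Real.exp (((((L ^ kk : ℕ) : ℝ))⁻¹) * (C / ξ))))) ^ 2 + @basisConst ι _ (Matrix mm mm ℂ) Matrix.frobeniusNormedAddCommGroup Matrix.frobeniusNormedSpace e * (2 * Real.sqrt (Fintype.card mm)) * (Real.sqrt (Fintype.card mm) * ((C / ξ ^ 2) * Real.exp (((((L ^ kk : ℕ) : ℝ))⁻¹) * (C / ξ)))))) ≤ rV →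
        rV * (1 + Fintype.card (Fin (d + 1) ⊕ Fin (d + 1))) + a₀ * (Fintype.card ι * (Fintype.card ι * ((1 + rV * ((((L ^ kk : ℕ) : ℝ))⁻¹)) ^ ((d + 1) * L ^ kk) - 1) ^ 2 + 2 * ((1 + rV * ((((L ^ kk : ℕ) : ℝ))⁻¹)) ^ ((d + 1) * L ^ kk) - 1))) ≤ R₀ →
      ∃ w : (Fin (d + 1) → ZMod (2 * L)) → ScX d L mv kk hL → Matrix mm mm ℂ, (∀ k x, (w k x)ᴴ * w k x = 1) ∧
        (∀ μ, HasMaj (ScNorm d L mv kk hL ι) (ScNorm d L mv kk hL ι)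
            (covD ((((L ^ kk : ℕ) : ℝ))⁻¹) (fun x => coordMat e (ContinuousLinearMap.mulLeftRight ℝ (Matrix mm mm ℂ) (U μ x : Matrix mm mm ℂ) (U μ x : Matrix mm mm ℂ)ᴴ)) (scShift d L mv kk hL μ) ∘ₗ
              scGlued d L mv kk hL (aK a₀ (L : ℝ) kk * (((L ^ kk : ℕ) : ℝ)) ^ (d + 1)) ((((L ^ kk : ℕ) : ℝ))⁻¹) ι e w (fun μ x => (U μ x : Matrix mm mm ℂ)) (scP d L mv kk hL (aK a₀ (L : ℝ) kk * (((L ^ kk : ℕ) : ℝ)) ^ (d + 1)) ι e (fun μ x => (U μ x : Matrix mm mm ℂ))) (scNV d L mv kk hL (aK a₀ (L : ℝ) kk * (((L ^ kk : ℕ) : ℝ)) ^ (d + 1)) ι e w (fun μ x => (U μ x : Matrix mm mm ℂ))))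
          (fun y y' => (1 * (1 + rV * Real.exp δ * cR) + π) * B * Real.exp (-(δ / 16 * (unitTorusGeo L kk (cvM d L mv kk hL)).dist y y')))) ∧
        (scGlued d L mv kk hL (aK a₀ (L : ℝ) kk * (((L ^ kk : ℕ) : ℝ)) ^ (d + 1)) ((((L ^ kk : ℕ) : ℝ))⁻¹) ι e w (fun μ x => (U μ x : Matrix mm mm ℂ)) (scP d L mv kk hL (aK a₀ (L : ℝ) kk * (((L ^ kk : ℕ) : ℝ)) ^ (d + 1)) ι e (fun μ x => (U μ x : Matrix mm mm ℂ))) (scNV d L mv kk hL (aK a₀ (L : ℝ) kk * (((L ^ kk : ℕ) : ℝ)) ^ (d + 1)) ι e w (fun μ x => (U μ x : Matrix mm mm ℂ))) ∘ₗ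
            (covLapM (scShift d L mv kk hL) ((((L ^ kk : ℕ) : ℝ))⁻¹) (gaugePair (scShift d L mv kk hL) (fun μ x => coordMat e (ContinuousLinearMap.mulLeftRight ℝ (Matrix mm mm ℂ) (U μ x : Matrix mm mm ℂ) (U μ x : Matrix mm mm ℂ)ᴴ))) +
              (scP d L mv kk hL (aK a₀ (L : ℝ) kk * (((L ^ kk : ℕ) : ℝ)) ^ (d + 1)) ι e (fun μ x => (U μ x : Matrix mm mm ℂ)))) = LinearMap.id ∧
          (covLapM (scShift d L mv kk hL) ((((L ^ kk : ℕ) : ℝ))⁻¹) (gaugePair (scShift d L mv kk hL) (fun μ x => coordMat e (ContinuousLinearMap.mulLeftRight ℝ (Matrix mm mm ℂ) (U μ x : Matrix mm mm ℂ) (U μ x : Matrix mm mm ℂ)ᴴ))) +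
              (scP d L mv kk hL (aK a₀ (L : ℝ) kk * (((L ^ kk : ℕ) : ℝ)) ^ (d + 1)) ι e (fun μ x => (U μ x : Matrix mm mm ℂ)))) ∘ₗ
            scGlued d L mv kk hL (aK a₀ (L : ℝ) kk * (((L ^ kk : ℕ) : ℝ)) ^ (d + 1)) ((((L ^ kk : ℕ) : ℝ))⁻¹) ι e w (fun μ x => (U μ x : Matrix mm mm ℂ)) (scP d L mv kk hL (aK a₀ (L : ℝ) kk * (((L ^ kk : ℕ) : ℝ)) ^ (d + 1)) ι e (fun μ x => (U μ x : Matrix mm mm ℂ))) (scNV d L mv kk hL (aK a₀ (L : ℝ) kk * (((L ^ kk : ℕ) : ℝ)) ^ (d + 1)) ι e w (fun μ x => (U μ x : Matrix mm mm ℂ))) = LinearMap.id) := by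
  obtain ⟨δ, w₀, R₀, θ₀, B, cR, hδ, hR₀, hθ₀, hB, hcR, HJ⟩ := uN_scGluedCovD_spec (d := d) hL hL7 ha₀ ι
  obtain ⟨δ₁, w₁, R₁, θ₁, B₁, hδ₁, hR₁, hθ₁, hB₁, H⟩ := uN_scGlued_spec (d := d) hL hL7 ha₀ ι
  have hL1r : (1 : ℝ) < (L : ℝ) := by exact_mod_cast hL.2
  have hL3 : 3 ≤ L := by omega
  refine ⟨δ, max (max w₀ w₁) 2, min R₀ R₁, B, cR, hδ, lt_min hR₀ hR₁, hB, hcR, fun mv kk hk hw₀ => ?_⟩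
  intro mm _ _ _ e he U hU ξ C hξ hC h335 rV hrV hrA hrC hRle
  have hw₀' : w₀ ≤ ((L ^ mv : ℕ) : ℝ) := ((le_max_left _ _).trans (le_max_left _ _)).trans hw₀
  have hw₁' : w₁ ≤ ((L ^ mv : ℕ) : ℝ) := ((le_max_right _ _).trans (le_max_left _ _)).trans hw₀
  have hW2 : 2 ≤ L ^ mv := by have h := (le_max_right (max w₀ w₁) 2).trans hw₀; exact_mod_cast h
  have hw : 0 < L ^ mv := by omega
  have hη : (0 : ℝ) < (((((L ^ kk : ℕ) : ℝ))⁻¹)) := inv_pos.mpr (Nat.cast_pos.mpr (pow_pos (Nat.pos_of_ne_zero (NeZero.ne L)) kk))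
  have hnr : (0 : ℝ) < ((L ^ kk : ℕ) : ℝ) := by exact_mod_cast pow_pos (Nat.pos_of_ne_zero (NeZero.ne L)) kk
  have hM : ∀ ν, cvM d L mv kk hL ν = 2 * L * L ^ mv := MP_succ_eq L mv kk hL
  have hm₁ : 2 * L ^ mv ≤ coverMargin L mv := two_mul_le_coverMargin hL7 mv
  have hfitI : coverMargin L mv - 2 * L ^ mv + (6 * L ^ mv + 1) ≤ L * L ^ mv := coverMargin_inner_fit hL7 hW2
  have hS0 : L * L ^ mv ≤ 2 * L * L ^ mv := by rw [mul_assoc]; omega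
  have hS5 : 6 * L ^ mv + 5 ≤ 2 * L * L ^ mv := by
    have h7 : 7 * L ^ mv ≤ L * L ^ mv := Nat.mul_le_mul_right _ hL7
    have e2 : 2 * L * L ^ mv = 2 * (L * L ^ mv) := by ring
    rw [e2]; omega
  -- King's window at the index
  have haK : 0 < aK a₀ (L : ℝ) kk := aK_pos ha₀ hL1r hk
  have haKle : aK a₀ (L : ℝ) kk ≤ a₀ := aK_le ha₀ hL1r hk
  have ha' : 0 < (aK a₀ (L : ℝ) kk * (((L ^ kk : ℕ) : ℝ)) ^ (d + 1)) := by positivity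
  -- the letter of the cut row
  have hσ0 : 0 ≤ ((1 + rV * ((((L ^ kk : ℕ) : ℝ))⁻¹)) ^ ((d + 1) * L ^ kk) - 1) := by
    have := one_le_pow₀ (M₀ := ℝ) (a := 1 + rV * ((((L ^ kk : ℕ) : ℝ))⁻¹)) (by nlinarith [hη.le]) (n := (d + 1) * L ^ kk); linarith
  have hLσ0 : 0 ≤ (Fintype.card ι * (Fintype.card ι * ((1 + rV * ((((L ^ kk : ℕ) : ℝ))⁻¹)) ^ ((d + 1) * L ^ kk) - 1) ^ 2 + 2 * ((1 + rV * ((((L ^ kk : ℕ) : ℝ))⁻¹)) ^ ((d + 1) * L ^ kk) - 1))) := by positivity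
  have hRN0 : 0 ≤ aK a₀ (L : ℝ) kk * (Fintype.card ι * (Fintype.card ι * ((1 + rV * ((((L ^ kk : ℕ) : ℝ))⁻¹)) ^ ((d + 1) * L ^ kk) - 1) ^ 2 + 2 * ((1 + rV * ((((L ^ kk : ℕ) : ℝ))⁻¹)) ^ ((d + 1) * L ^ kk) - 1))) := by positivity
  have hRle' : rV * (1 + Fintype.card (Fin (d + 1) ⊕ Fin (d + 1))) + aK a₀ (L : ℝ) kk * (Fintype.card ι * (Fintype.card ι * ((1 + rV * ((((L ^ kk : ℕ) : ℝ))⁻¹)) ^ ((d + 1) * L ^ kk) - 1) ^ 2 + 2 * ((1 + rV * ((((L ^ kk : ℕ) : ℝ))⁻¹)) ^ ((d + 1) * L ^ kk) - 1))) ≤ min R₀ R₁ := by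
    have := mul_le_mul_of_nonneg_right haKle hLσ0; linarith
  have habs : |(aK a₀ (L : ℝ) kk * (((L ^ kk : ℕ) : ℝ)) ^ (d + 1))| * ((((L ^ kk : ℕ) : ℝ)) ^ (d + 1))⁻¹ = aK a₀ (L : ℝ) kk := by
    rw [abs_of_pos ha', mul_assoc, mul_inv_cancel₀ (by positivity), mul_one]
  -- the per-cube gauges and their (3.35) letters from the class on the two-collar boxes (dag-n15-w2): at the cut box (262's `hCloc`, `hAloc`) and one step before it (274's letter)
  choose w hwu hwL using fun k => uN_exists_gauge_localCoefLetters_of_reg335Cube e (scShift d L mv kk hL) U he hη hU hξ hC (h335 k)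
  have hin : ∀ k (x : ScX d L mv kk hL), x ∈ {x : ScX d L mv kk hL | blockOf (L ^ kk) (cvM d L mv kk hL) x ∈ cubeBlocks (cvM d L mv kk hL) (coverCorner (cvM d L mv kk hL) (L ^ mv) L (2 * L ^ mv + 1) k) (6 * L ^ mv + 3)} → x ∈ {x : ScX d L mv kk hL | blockOf (L ^ kk) (cvM d L mv kk hL) x ∈ cubeBlocks (cvM d L mv kk hL) (coverCorner (cvM d L mv kk hL) (L ^ mv) L (2 * L ^ mv + 2) k) (6 * L ^ mv + 5)} := fun k x hx =>
    mem_cubeBlocks_of_mem_inner (m₀ := 2 * L ^ mv + 2) (S₀ := 6 * L ^ mv + 5) hM (by omega) (by omega) hS5 hx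
  have hwC : ∀ k x, scChi d L mv kk hL k x ≠ 0 → ∀ i, ∑ j, |tCoefC ((((L ^ kk : ℕ) : ℝ))⁻¹) (gaugePair (scShift d L mv kk hL) fun μ y => coordMat e (ContinuousLinearMap.mulLeftRight ℝ (Matrix mm mm ℂ) (w k y * (U μ y : Matrix mm mm ℂ) * (w k (scShift d L mv kk hL μ y))ᴴ) (w k y * (U μ y : Matrix mm mm ℂ) * (w k (scShift d L mv kk hL μ y))ᴴ)ᴴ)) x i j| ≤ rV :=
    fun k x hx i => by
      obtain ⟨h0, h1, h2⟩ := scChi_ne_zero_nbhd hL hL7 mv kk k x hx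
      exact (((hwL k) x (hin k x h0) (fun μ => hin k _ (h1 μ)) (fun μ => hin k _ (h2 μ))).2 i).trans hrC
  have hwA : ∀ k j' x, scChi d L mv kk hL k x ≠ 0 → ∀ i, ∑ j, |tCoefA ((((L ^ kk : ℕ) : ℝ))⁻¹) (gaugePair (scShift d L mv kk hL) fun μ y => coordMat e (ContinuousLinearMap.mulLeftRight ℝ (Matrix mm mm ℂ) (w k y * (U μ y : Matrix mm mm ℂ) * (w k (scShift d L mv kk hL μ y))ᴴ) (w k y * (U μ y : Matrix mm mm ℂ) * (w k (scShift d L mv kk hL μ y))ᴴ)ᴴ)) j' x i j| ≤ rV :=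
    fun k j' x hx i => by
      obtain ⟨h0, h1, h2⟩ := scChi_ne_zero_nbhd hL hL7 mv kk k x hx
      exact (((hwL k) x (hin k x h0) (fun μ => hin k _ (h1 μ)) (fun μ => hin k _ (h2 μ))).1 j' i).trans hrA
  have hwAμ : ∀ (μ : Fin (d + 1)) k x, scChi d L mv kk hL k (scShift d L mv kk hL μ x) ≠ 0 → ∀ i, ∑ j, |tCoefA ((((L ^ kk : ℕ) : ℝ))⁻¹) (gaugePair (scShift d L mv kk hL) fun ν y => coordMat e (ContinuousLinearMap.mulLeftRight ℝ (Matrix mm mm ℂ) (w k y * (U ν y : Matrix mm mm ℂ) * (w k (scShift d L mv kk hL ν y))ᴴ) (w k y * (U ν y : Matrix mm mm ℂ) * (w k (scShift d L mv kk hL ν y))ᴴ)ᴴ)) (Sum.inl μ) x i j| ≤ rV :=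
    fun μ k x hx i => by
      obtain ⟨h0, h1, h2⟩ := scShift_nbhd_mem_box2 hL hL7 mv kk hW2 k μ x hx
      exact (((hwL k) x h0 h1 h2).1 (Sum.inl μ) i).trans hrA
  -- 262's displayed rows for `P := scP`, `N_V := scNV` (265's discharges) at both rates
  have hPc := fun k => scP_conj ι e (aK a₀ (L : ℝ) kk * (((L ^ kk : ℕ) : ℝ)) ^ (d + 1)) w (fun μ x => (U μ x : Matrix mm mm ℂ)) k
  have hNV : ∀ (ρ : ℝ) k, HasMaj (ScNorm d L mv kk hL ι) (ScNorm d L mv kk hL ι) (mulOp (fun p : ScX d L mv kk hL × ι => scPsi d L mv kk hL k p.1) ∘ₗ (scNV d L mv kk hL (aK a₀ (L : ℝ) kk * (((L ^ kk : ℕ) : ℝ)) ^ (d + 1)) ι e w (fun μ x => (U μ x : Matrix mm mm ℂ))) k ∘ₗ mulOp (fun p : ScX d L mv kk hL × ι => scChi d L mv kk hL k p.1))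
      (fun y y' => aK a₀ (L : ℝ) kk * (Fintype.card ι * (Fintype.card ι * ((1 + rV * ((((L ^ kk : ℕ) : ℝ))⁻¹)) ^ ((d + 1) * L ^ kk) - 1) ^ 2 + 2 * ((1 + rV * ((((L ^ kk : ℕ) : ℝ))⁻¹)) ^ ((d + 1) * L ^ kk) - 1))) * Real.exp (-(ρ * (unitTorusGeo L kk (cvM d L mv kk hL)).dist y y'))) := fun ρ k =>
    (hasMaj_scNV_cut_of_rows ι e he (aK a₀ (L : ℝ) kk * (((L ^ kk : ℕ) : ℝ)) ^ (d + 1)) (fun k x => hwu k x) (fun μ x => (U μ x : Matrix mm mm ℂ)) hrV k (fun μ x hx i => hwA k (Sum.inl μ) x hx i) ρ).mono fun y y' =>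
      mul_le_mul_of_nonneg_right (le_of_eq (by rw [habs])) (Real.exp_nonneg _)
  have hfar : ∀ (ρ θ : ℝ), 0 ≤ θ → ∀ k, HasMaj (ScNorm d L mv kk hL ι) (ScNorm d L mv kk hL ι) ((LinearMap.id - mulOp (fun p : ScX d L mv kk hL × ι => scPsi d L mv kk hL k p.1)) ∘ₗ (scNV d L mv kk hL (aK a₀ (L : ℝ) kk * (((L ^ kk : ℕ) : ℝ)) ^ (d + 1)) ι e w (fun μ x => (U μ x : Matrix mm mm ℂ))) k ∘ₗ mulOp (fun p : ScX d L mv kk hL × ι => scChi d L mv kk hL k p.1))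
      (fun y y' => θ * Real.exp (-(ρ * (unitTorusGeo L kk (cvM d L mv kk hL)).dist y y'))) := fun ρ θ hθ k => by
    rw [one_sub_scPsi_comp_scNV_comp_scChi ι e he hM hm₁ hfitI hS0 (aK a₀ (L : ℝ) kk * (((L ^ kk : ℕ) : ℝ)) ^ (d + 1)) (fun k x => hwu k x) (fun μ x => (U μ x : Matrix mm mm ℂ)) k]
    exact (hasMaj_zero _ _).mono fun y y' => by positivity
  refine ⟨w, fun k x => hwu k x, fun μ => ?_, ?_⟩
  · exact HJ mv kk hk hw₀' e he w (fun k x => hwu k x) (fun μ x => (U μ x : Matrix mm mm ℂ)) (scP d L mv kk hL (aK a₀ (L : ℝ) kk * (((L ^ kk : ℕ) : ℝ)) ^ (d + 1)) ι e (fun μ x => (U μ x : Matrix mm mm ℂ))) (scNV d L mv kk hL (aK a₀ (L : ℝ) kk * (((L ^ kk : ℕ) : ℝ)) ^ (d + 1)) ι e w (fun μ x => (U μ x : Matrix mm mm ℂ))) rV (aK a₀ (L : ℝ) kk * (Fintype.card ι * (Fintype.card ι * ((1 + rV * ((((L ^ kk : ℕ) : ℝ))⁻¹)) ^ ((d + 1)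 * L ^ kk) - 1) ^ 2 + 2 * ((1 + rV * ((((L ^ kk : ℕ) : ℝ))⁻¹)) ^ ((d + 1) * L ^ kk) - 1)))) 0 hrV hRN0 le_rfl (hRle'.trans (min_le_left _ _)) hθ₀.le
      hPc (fun k => hwC k) (fun k => hwA k) (hNV δ) (hfar δ 0 le_rfl) μ rV hrV (hwAμ μ)
  · exact (H mv kk hk hw₁' e he w (fun k x => hwu k x) (fun μ x => (U μ x : Matrix mm mm ℂ)) (scP d L mv kk hL (aK a₀ (L : ℝ) kk * (((L ^ kk : ℕ) : ℝ)) ^ (d + 1)) ι e (fun μ x => (U μ x : Matrix mm mm ℂ))) (scNV d L mv kk hL (aK a₀ (L : ℝ) kk * (((L ^ kk : ℕ) : ℝ)) ^ (d + 1)) ι e w (fun μ x => (U μ x : Matrix mm mm ℂ))) rV (aK a₀ (L : ℝ) kk * (Fintype.card ι * (Fintype.card ι * ((1 + rV * ((((L ^ kk : ℕ) : ℝ))⁻¹)) ^ ((d + 1) * L ^ kk) - 1) ^ 2 + 2 * ((1 + rV * ((((L ^ kk : ℕ) : ℝ))⁻¹)) ^ ((d + 1) * L ^ kk) - 1)))) 0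 hrV hRN0 le_rfl (hRle'.trans (min_le_right _ _)) hθ₁.le
      hPc (fun k => hwC k) (fun k => hwA k) (hNV δ₁) (hfar δ₁ 0 le_rfl)).2

end Green

end Summit.QuantumFields.YangMills.BalabanUVNodes.N15.Gluing

end
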